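import Literature.NumberTheory.GaloisRepresentations.ContinuousCohomologyBockstein
import Mathlib.Topology.Instances.AddCircle.Defs
import HarnessLib

/-!
# `H²(G, ℤ) ≅ Hom_cont(G, ℚ/ℤ)` and `H²(Ẑ, ℤ) ≅ ℚ/ℤ`: the discrete coefficient modules
# `ℤ ⊆ ℚ ↠ ℚ/ℤ` in a universe and the instantiated Bockstein equivalences

Topic `NumberTheory/GaloisRepresentations`; namespace `Literature.NumberTheory.GaloisRepresentations`.
Companion of `ContinuousCohomologyBockstein.lean`, which proves the continuous Bockstein
isomorphism `δ₁ : H¹(G, M₃) ⥲ H²(G, M₁)` for an ARBITRARY short exact sequence of discrete modules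
with uniquely divisible middle term (`IsSES.δ₁Equiv`, `IsSES.H2EquivContOneCocycles`,
`IsSES.H2EquivOfDenseZpowers`).  Mathlib's continuous cohomology needs the coefficients to be
topological modules in the universe of the group, and Mathlib's `ℚ` and `AddCircle (1 : ℚ) = ℚ/ℤ`
carry their order/quotient topologies, which are NOT discrete; this file therefore fixes once and
for all the DISCRETE models

* `ZCoeff.{u} = ULift ℤ` (already discrete), `QCoeff.{u}` (`ULift ℚ` with the discrete topology),
  `QModZCoeff.{u}` (`ULift (AddCircle (1 : ℚ))` with the discrete topology; as a bare group this is
  the abc-iut cell's `QmodZ`), the maps `ZCoeff.toQ`, `QCoeff.toQModZ`, their exactness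
  (`QCoeff.toQModZ_eq_zero_iff`), `QCoeff.bijective_smul` (`ℚ` is uniquely divisible) and
  `QModZCoeff.isOfFinAddOrder` (`ℚ/ℤ` is torsion);
* `isSES_ZQ G` — the short exact sequence `0 → ℤ → ℚ → ℚ/ℤ → 0` of trivial discrete `G`-modules;

and instantiates the Bockstein file:

* `H2IntEquivHom G : H²(G, ℤ) ≃ₗ[ℤ] Hom_cont(G, ℚ/ℤ)` (`= contOneCocycles` of the trivial module
  `ℚ/ℤ`) for every profinite group `G`, with `H2IntEquivHom_symm_apply : … = δ [φ]`
  [Serre, *Local Fields*, XIII §1];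
* `H2IntEquivQModZ hγ hidx : H²(G, ℤ) ≃ₗ[ℤ] ℚ/ℤ`, `[c] ↦ (δ⁻¹[c])(γ)`, for `G` profinite with a
  dense cyclic subgroup `γ^ℤ` and an open subgroup of every positive index — i.e. `G ≅ Ẑ`
  topologically generated by `γ`; for the abc-iut cell's `FundamentalExtension.IsFreeProcyclic G`
  feed its two fields `exists_dense_zpowers.choose_spec` / `exists_isOpen_index` — with
  `H2IntEquivQModZ_symm_apply_eq : (…)⁻¹ x = δ [φ]` for every continuous `φ : G → ℚ/ℤ` with
  `φ(γ) = x` ("`H²(Ẑ, ℤ) ⥲ ℚ/ℤ`, the class of invariant `x` is the Bockstein of the character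
  `F ↦ x`") [Serre, *Local Fields*, XIII §3; Cassels–Fröhlich VI §1.1].

Consumers (abc-iut cell, by name): [AbsTopIII] Prop. 3.2 (i) row P32.i.L05 `Prop32iChain.toQmodZ`
(`H2ZhatZ := continuousCohomology 2 (ZCoeff-trivial module)`, `toQmodZ := (H2IntEquivQModZ …)` then
`QModZCoeff.equivULift`); [AbsAnab] Prop. 1.2.1 (vii) rows L04/L05′.  Honest framing: textbook
material; nothing here bears on abc or takes a side on [IUTchIII] Cor. 3.12.

## References
* J.-P. Serre, *Local Fields* (1979), XIII §1, XIII §3. [SerreLocalFields1979]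
* J. W. S. Cassels, A. Fröhlich (eds.), *Algebraic Number Theory* (1967), Ch. VI §1.1.
  [CasselsFrohlichANT1967]
-/

noncomputable section

open CategoryTheory Function

universe u

namespace Literature.NumberTheory.GaloisRepresentations

open _root_.TopRep _root_.ContRepresentation _root_.ContinuousCohomology _root_.Topology

/-! ### §1 The discrete coefficient groups `ℤ`, `ℚ`, `ℚ/ℤ` in universe `u` -/

/-- `ℤ` as a discrete additive group in universe `u` (trivial coefficient module).
[cite: SerreLocalFields1979, XIII §1] -/
abbrev ZCoeff : Type u := ULift.{u} ℤ

/-- `ℚ` as an additive group in universe `u`, to be equipped with the DISCRETE topology (Mathlib's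
`ℚ` carries the order topology). [cite: SerreLocalFields1979, XIII §1] -/
def QCoeff : Type u := ULift.{u} ℚ

namespace QCoeff

/-- The additive group structure of `ℚ`, transported. [cite: SerreLocalFields1979, XIII §1] -/
instance : AddCommGroup QCoeff.{u} := inferInstanceAs (AddCommGroup (ULift.{u} ℚ))

/-- The DISCRETE topology on the coefficient group `ℚ`. [cite: SerreLocalFields1979, XIII §1] -/
instance : TopologicalSpace QCoeff.{u} := ⊥

/-- The coefficient group `ℚ` is discrete. [cite: SerreLocalFields1979, XIII §1] -/
instance : DiscreteTopology QCoeff.{u} := ⟨rfl⟩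

/-- `QCoeff` is `ULift ℚ` as an additive group. [cite: SerreLocalFields1979, XIII §1] -/
def equivULift : QCoeff.{u} ≃+ ULift.{u} ℚ := AddEquiv.refl _

/-- The rational number underlying an element of `QCoeff`. [cite: SerreLocalFields1979, XIII §1] -/
def val (q : QCoeff.{u}) : ℚ := (equivULift q).down

/-- The element of `QCoeff` with given value. [cite: SerreLocalFields1979, XIII §1] -/
def mk (r : ℚ) : QCoeff.{u} := equivULift.symm ⟨r⟩

/-- `val (mk r) = r`. [cite: SerreLocalFields1979, XIII §1] -/
@[simp] theorem val_mk (r : ℚ) : val (mk.{u} r) = r := rfl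

/-- `mk (val q) = q`. [cite: SerreLocalFields1979, XIII §1] -/
@[simp] theorem mk_val (q : QCoeff.{u}) : mk (val q) = q := rfl

/-- `val` is additive. [cite: SerreLocalFields1979, XIII §1] -/
@[simp] theorem val_add (q q' : QCoeff.{u}) : val (q + q') = val q + val q' := rfl

/-- `val` commutes with integer multiples. [cite: SerreLocalFields1979, XIII §1] -/
@[simp] theorem val_zsmul (n : ℤ) (q : QCoeff.{u}) : val (n • q) = n • val q := rfl

/-- `val 0 = 0`. [cite: SerreLocalFields1979, XIII §1] -/
@[simp] theorem val_zero : val (0 : QCoeff.{u}) = 0 := rfl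

/-- `val` is injective. [cite: SerreLocalFields1979, XIII §1] -/
theorem val_injective : Function.Injective (val : QCoeff.{u} → ℚ) := fun q q' h => by
  rw [← mk_val q, ← mk_val q', h]

/-- **`ℚ` is uniquely divisible**: multiplication by a positive integer is bijective on `QCoeff`.
[cite: SerreLocalFields1979, XIII §1] -/
theorem bijective_smul (n : ℕ) (hn : 0 < n) :
    Function.Bijective fun q : QCoeff.{u} => (n : ℤ) • q := by
  have hn' : (n : ℚ) ≠ 0 := Nat.cast_ne_zero.mpr (Nat.pos_iff_ne_zero.mp hn)
  constructor
  · intro q q' h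
    apply val_injective
    have h' : (n : ℚ) * val q = (n : ℚ) * val q' := by
      have h'' := congrArg val h
      rwa [val_zsmul, val_zsmul, zsmul_eq_mul, zsmul_eq_mul, Int.cast_natCast] at h''
    exact mul_left_cancel₀ hn' h'
  · intro q
    refine ⟨mk (val q / n), val_injective ?_⟩
    change val ((n : ℤ) • mk (val q / n)) = val q
    rw [val_zsmul, val_mk, zsmul_eq_mul, Int.cast_natCast, mul_div_cancel₀ _ hn']

end QCoeff

/-- `ℚ/ℤ` as an additive group in universe `u` (`ULift (AddCircle (1 : ℚ))`, the abc-iut cell's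
`QmodZ`), to be equipped with the DISCRETE topology (Mathlib's `AddCircle` carries the quotient
topology). [cite: SerreLocalFields1979, XIII §1] -/
def QModZCoeff : Type u := ULift.{u} (AddCircle (1 : ℚ))

namespace QModZCoeff

/-- The additive group structure of `ℚ/ℤ = AddCircle (1 : ℚ)`, transported.
[cite: SerreLocalFields1979, XIII §1] -/
instance : AddCommGroup QModZCoeff.{u} := inferInstanceAs (AddCommGroup (ULift.{u} (AddCircle (1 : ℚ))))

/-- The DISCRETE topology on the coefficient group `ℚ/ℤ`. [cite: SerreLocalFields1979, XIII §1] -/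
instance : TopologicalSpace QModZCoeff.{u} := ⊥

/-- The coefficient group `ℚ/ℤ` is discrete. [cite: SerreLocalFields1979, XIII §1] -/
instance : DiscreteTopology QModZCoeff.{u} := ⟨rfl⟩

/-- `QModZCoeff` is `ULift (AddCircle (1 : ℚ))` (the cell's `QmodZ`) as an additive group.
[cite: SerreLocalFields1979, XIII §1] -/
def equivULift : QModZCoeff.{u} ≃+ ULift.{u} (AddCircle (1 : ℚ)) := AddEquiv.refl _

/-- The element of `AddCircle (1 : ℚ) = ℚ/ℤ` underlying an element of `QModZCoeff`.
[cite: SerreLocalFields1979, XIII §1] -/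
def val (x : QModZCoeff.{u}) : AddCircle (1 : ℚ) := (equivULift x).down

/-- The element of `QModZCoeff` with given value. [cite: SerreLocalFields1979, XIII §1] -/
def mk (t : AddCircle (1 : ℚ)) : QModZCoeff.{u} := equivULift.symm ⟨t⟩

/-- `val (mk t) = t`. [cite: SerreLocalFields1979, XIII §1] -/
@[simp] theorem val_mk (t : AddCircle (1 : ℚ)) : val (mk.{u} t) = t := rfl

/-- `mk (val x) = x`. [cite: SerreLocalFields1979, XIII §1] -/
@[simp] theorem mk_val (x : QModZCoeff.{u}) : mk (val x) = x := rfl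

/-- `val` is additive. [cite: SerreLocalFields1979, XIII §1] -/
@[simp] theorem val_add (x y : QModZCoeff.{u}) : val (x + y) = val x + val y := rfl

/-- `val` commutes with natural multiples. [cite: SerreLocalFields1979, XIII §1] -/
@[simp] theorem val_nsmul (n : ℕ) (x : QModZCoeff.{u}) : val (n • x) = n • val x := rfl

/-- `val 0 = 0`. [cite: SerreLocalFields1979, XIII §1] -/
@[simp] theorem val_zero : val (0 : QModZCoeff.{u}) = 0 := rfl

/-- `val` is injective. [cite: SerreLocalFields1979, XIII §1] -/
theorem val_injective : Function.Injective (val : QModZCoeff.{u} → AddCircle (1 : ℚ)) := fun x y h => by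
  rw [← mk_val x, ← mk_val y, h]

/-- **`ℚ/ℤ` is a torsion group**: every element of `QModZCoeff` has finite order (the class of
`a/b` is killed by `b`). [cite: SerreLocalFields1979, XIII §1] -/
theorem isOfFinAddOrder (x : QModZCoeff.{u}) : IsOfFinAddOrder x := by
  obtain ⟨r, hr⟩ : ∃ r : ℚ, (r : AddCircle (1 : ℚ)) = val x := Quot.exists_rep (val x)
  have hord : addOrderOf (val x) = r.den := by
    rw [← hr]
    have h := AddCircle.addOrderOf_coe_rat (𝕜 := ℚ) (p := (1 : ℚ)) (q := r)
    rwa [Rat.cast_id, mul_one] at h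
  rw [isOfFinAddOrder_iff_nsmul_eq_zero]
  refine ⟨r.den, r.den_pos, val_injective ?_⟩
  rw [val_nsmul, val_zero, ← hord, addOrderOf_nsmul_eq_zero]

end QModZCoeff

/-- The inclusion `ℤ ↪ ℚ` on the coefficient groups. [cite: SerreLocalFields1979, XIII §1] -/
def ZCoeff.toQ : ZCoeff.{u} →+ QCoeff.{u} where
  toFun n := QCoeff.mk (n.down : ℚ)
  map_zero' := QCoeff.val_injective (by
    change QCoeff.val (QCoeff.mk (((0 : ZCoeff.{u}).down : ℤ) : ℚ)) = QCoeff.val 0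
    rw [QCoeff.val_mk, QCoeff.val_zero]
    exact Int.cast_zero)
  map_add' a b := QCoeff.val_injective (by
    change QCoeff.val (QCoeff.mk (((a + b).down : ℤ) : ℚ)) =
      QCoeff.val (QCoeff.mk ((a.down : ℤ) : ℚ) + QCoeff.mk ((b.down : ℤ) : ℚ))
    rw [QCoeff.val_add, QCoeff.val_mk, QCoeff.val_mk, QCoeff.val_mk]
    exact Int.cast_add _ _)

/-- `val (toQ n) = n`. [cite: SerreLocalFields1979, XIII §1] -/
@[simp] theorem ZCoeff.val_toQ (n : ZCoeff.{u}) : QCoeff.val (ZCoeff.toQ n) = (n.down : ℚ) := rfl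

/-- The projection `ℚ ↠ ℚ/ℤ` on the coefficient groups. [cite: SerreLocalFields1979, XIII §1] -/
def QCoeff.toQModZ : QCoeff.{u} →+ QModZCoeff.{u} where
  toFun q := QModZCoeff.mk (q.val : AddCircle (1 : ℚ))
  map_zero' := QModZCoeff.val_injective (by
    change QModZCoeff.val (QModZCoeff.mk (((0 : QCoeff.{u}).val : ℚ) : AddCircle (1 : ℚ))) =
      QModZCoeff.val 0
    rw [QModZCoeff.val_mk, QModZCoeff.val_zero, QCoeff.val_zero, QuotientAddGroup.mk_zero])
  map_add' a b := QModZCoeff.val_injective (by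
    change QModZCoeff.val (QModZCoeff.mk (((a + b).val : ℚ) : AddCircle (1 : ℚ))) =
      QModZCoeff.val (QModZCoeff.mk ((a.val : ℚ) : AddCircle (1 : ℚ)) +
        QModZCoeff.mk ((b.val : ℚ) : AddCircle (1 : ℚ)))
    rw [QModZCoeff.val_add, QModZCoeff.val_mk, QModZCoeff.val_mk, QModZCoeff.val_mk,
      QCoeff.val_add, QuotientAddGroup.mk_add])

/-- `val (toQModZ q) = ↑(val q)`. [cite: SerreLocalFields1979, XIII §1] -/
@[simp] theorem QCoeff.val_toQModZ (q : QCoeff.{u}) :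
    QModZCoeff.val (QCoeff.toQModZ q) = ((QCoeff.val q : ℚ) : AddCircle (1 : ℚ)) := rfl

/-- `ℤ ↪ ℚ` is injective. [cite: SerreLocalFields1979, XIII §1] -/
theorem ZCoeff.toQ_injective : Function.Injective (ZCoeff.toQ.{u}) := fun a b h => by
  have h' : ((a.down : ℤ) : ℚ) = ((b.down : ℤ) : ℚ) := by
    rw [← ZCoeff.val_toQ, ← ZCoeff.val_toQ, h]
  exact ULift.down_injective (Int.cast_injective h')

/-- `ℚ ↠ ℚ/ℤ` is surjective. [cite: SerreLocalFields1979, XIII §1] -/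
theorem QCoeff.toQModZ_surjective : Function.Surjective (QCoeff.toQModZ.{u}) := fun x => by
  obtain ⟨r, hr⟩ : ∃ r : ℚ, (r : AddCircle (1 : ℚ)) = QModZCoeff.val x := Quot.exists_rep _
  refine ⟨QCoeff.mk r, QModZCoeff.val_injective ?_⟩
  rw [QCoeff.val_toQModZ, QCoeff.val_mk, hr]

/-- **Exactness of `0 → ℤ → ℚ → ℚ/ℤ → 0` in the middle**: a rational number vanishes in `ℚ/ℤ` iff it
is an integer. [cite: SerreLocalFields1979, XIII §1] -/
theorem QCoeff.toQModZ_eq_zero_iff (q : QCoeff.{u}) :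
    QCoeff.toQModZ q = 0 ↔ q ∈ (ZCoeff.toQ.{u}).range := by
  constructor
  · intro h
    have h' : ((QCoeff.val q : ℚ) : AddCircle (1 : ℚ)) = 0 := by
      rw [← QCoeff.val_toQModZ, h, QModZCoeff.val_zero]
    obtain ⟨n, hn⟩ := (AddCircle.coe_eq_zero_iff (1 : ℚ)).mp h'
    refine ⟨⟨n⟩, QCoeff.val_injective ?_⟩
    rw [ZCoeff.val_toQ, ← hn, zsmul_eq_mul, mul_one]
  · rintro ⟨n, rfl⟩
    apply QModZCoeff.val_injective
    rw [QCoeff.val_toQModZ, ZCoeff.val_toQ, QModZCoeff.val_zero, AddCircle.coe_eq_zero_iff]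
    exact ⟨n.down, by rw [zsmul_eq_mul, mul_one]⟩

/-! ### §2 The short exact sequence of trivial discrete modules `0 → ℤ → ℚ → ℚ/ℤ → 0` -/

section SES

variable (G : Type u) [Group G] [TopologicalSpace G]

/-- **`0 → ℤ → ℚ → ℚ/ℤ → 0`** as a short exact sequence of TRIVIAL discrete `G`-modules (the input of
the Bockstein `δ : H¹(G, ℚ/ℤ) → H²(G, ℤ)`). [cite: SerreLocalFields1979, XIII §1] -/
theorem isSES_ZQ : IsSES (trivialHom G ZCoeff.toQ.{u}) (trivialHom G QCoeff.toQModZ.{u}) :=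
  IsSES.ofTrivial G _ _ ZCoeff.toQ_injective QCoeff.toQModZ_surjective QCoeff.toQModZ_eq_zero_iff

end SES

/-! ### §3 `H²(G, ℤ) ≅ Hom_cont(G, ℚ/ℤ)` and `H²(Ẑ, ℤ) ≅ ℚ/ℤ` -/

section H2

variable (G : Type u) [Group G] [TopologicalSpace G] [IsTopologicalGroup G] [CompactSpace G]
  [T2Space G] [TotallyDisconnectedSpace G]

/-- **`H²(G, ℤ) ≅ Hom_cont(G, ℚ/ℤ) (= G^∨)`** for a profinite group `G` (continuous cohomology of the
trivial discrete module `ℤ`; `Hom_cont(G, ℚ/ℤ)` = the continuous `1`-cocycles of the trivial discrete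
module `ℚ/ℤ`): the inverse Bockstein isomorphism composed with `H¹ = Hom` for the trivial action.
[cite: SerreLocalFields1979, XIII §1] -/
def H2IntEquivHom :
    continuousCohomology 2 (ContinuousRep.trivial G ℤ ZCoeff.{u}).toTopRep ≃ₗ[ℤ]
      contOneCocycles (ContinuousRep.trivial G ℤ QModZCoeff.{u}).toTopRep :=
  (isSES_ZQ G).H2EquivContOneCocycles QCoeff.bijective_smul (fun _ _ => rfl)

/-- `(H2IntEquivHom G)⁻¹ φ = δ [φ]`: the class attached to a continuous character `φ : G → ℚ/ℤ` is
its Bockstein. [cite: SerreLocalFields1979, XIII §1] -/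
theorem H2IntEquivHom_symm_apply
    (φ : contOneCocycles (ContinuousRep.trivial G ℤ QModZCoeff.{u}).toTopRep) :
    (H2IntEquivHom G).symm φ = (isSES_ZQ G).δ₁ (oneCocycleClass _ φ) :=
  rfl

variable {G}

/-- **`H²(G, ℤ) ≅ ℚ/ℤ`, `[c] ↦ (δ⁻¹ [c])(γ)`, for `G ≅ Ẑ` topologically generated by `γ`** — the
isomorphism "`H²(Ẑ, ℤ) ⥲ H¹(Ẑ, ℚ/ℤ) = Hom(Ẑ, ℚ/ℤ) → ℚ/ℤ`, `φ ↦ φ(F)`" through which the invariant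
`inv_K : Br(K) → ℚ/ℤ` of local class field theory is defined (`G = Gal(K^unr/K)`, `γ = F` the
Frobenius).  Hypotheses: `G` profinite, `γ^ℤ` dense, an open subgroup of every positive index (for the
abc-iut cell's `FundamentalExtension.IsFreeProcyclic G`: its two fields).
[cite: SerreLocalFields1979, XIII §3] -/
def H2IntEquivQModZ {γ : G} (hγ : Dense (Subgroup.zpowers γ : Set G))
    (hidx : ∀ n : ℕ, 0 < n → ∃ H : Subgroup G, IsOpen (H : Set G) ∧ H.index = n) :
    continuousCohomology 2 (ContinuousRep.trivial G ℤ ZCoeff.{u}).toTopRep ≃ₗ[ℤ] QModZCoeff.{u} :=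
  (isSES_ZQ G).H2EquivOfDenseZpowers QCoeff.bijective_smul (fun _ _ => rfl) hγ hidx
    QModZCoeff.isOfFinAddOrder

/-- `H2IntEquivQModZ z = (H2IntEquivHom G z)(γ)`. [cite: SerreLocalFields1979, XIII §3] -/
theorem H2IntEquivQModZ_apply {γ : G} (hγ : Dense (Subgroup.zpowers γ : Set G))
    (hidx : ∀ n : ℕ, 0 < n → ∃ H : Subgroup G, IsOpen (H : Set G) ∧ H.index = n)
    (z : continuousCohomology 2 (ContinuousRep.trivial G ℤ ZCoeff.{u}).toTopRep) :
    H2IntEquivQModZ hγ hidx z = (H2IntEquivHom G z).1 γ :=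
  rfl

/-- **The inverse**: `(H2IntEquivQModZ)⁻¹ x = δ [φ]` for EVERY continuous character `φ : G → ℚ/ℤ`
with `φ(γ) = x` — the class of `H²(Ẑ, ℤ)` with invariant `x ∈ ℚ/ℤ` is the Bockstein of the character
`F ↦ x`. [cite: SerreLocalFields1979, XIII §3] -/
theorem H2IntEquivQModZ_symm_apply_eq {γ : G} (hγ : Dense (Subgroup.zpowers γ : Set G))
    (hidx : ∀ n : ℕ, 0 < n → ∃ H : Subgroup G, IsOpen (H : Set G) ∧ H.index = n)
    (x : QModZCoeff.{u}) (φ : contOneCocycles (ContinuousRep.trivial G ℤ QModZCoeff.{u}).toTopRep)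
    (hφ : φ.1 γ = x) :
    (H2IntEquivQModZ hγ hidx).symm x = (isSES_ZQ G).δ₁ (oneCocycleClass _ φ) :=
  (isSES_ZQ G).H2EquivOfDenseZpowers_symm_apply_eq QCoeff.bijective_smul (fun _ _ => rfl) hγ hidx
    QModZCoeff.isOfFinAddOrder x φ hφ

omit [T2Space G] in
/-- Existence form: for `G ≅ Ẑ` topologically generated by `γ`, every `x ∈ ℚ/ℤ` is `φ(γ)` for a unique
continuous character `φ : G → ℚ/ℤ`. [cite: SerreLocalFields1979, XIII §3] -/
theorem existsUnique_character_apply_eq {γ : G} (hγ : Dense (Subgroup.zpowers γ : Set G))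
    (hidx : ∀ n : ℕ, 0 < n → ∃ H : Subgroup G, IsOpen (H : Set G) ∧ H.index = n)
    (x : QModZCoeff.{u}) :
    ∃! φ : contOneCocycles (ContinuousRep.trivial G ℤ QModZCoeff.{u}).toTopRep, φ.1 γ = x := by
  let e := contOneCocyclesEquivOfDenseZpowers (X := (ContinuousRep.trivial G ℤ QModZCoeff.{u}).toTopRep)
    (fun _ _ => rfl) hγ hidx QModZCoeff.isOfFinAddOrder
  refine ⟨e.symm x, ?_, fun φ hφ => ?_⟩
  · exact e.apply_symm_apply x
  · rw [LinearEquiv.eq_symm_apply]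
    exact hφ

end H2

end Literature.NumberTheory.GaloisRepresentations

end
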